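import Literature.MathematicalPhysics.KineticTheory.LangevinChainFlowBounds
import Mathlib.Analysis.Complex.ExponentialBounds
import HarnessLib

/-!
# Energy of the driven pinned chain at scale `K⁴`: force bounds, Grönwall, and the energy identity with dissipation

Trunk T-KINETIC (Literature/MathematicalPhysics/KineticTheory). Deterministic (pathwise) layer of
the provefact unit for `CuneoEckmannHairerReyBellet2018_H2` (CEHR Theorem 5.1 / Remark 5.2, the
Lyapunov condition H2 for `e^{θH}`; `LangevinChainDynkin.lean`, `LangevinChainH2.lean`).
Cuneo–Eckmann–Hairer–Rey-Bellet, EJP 23 (2018) no. 55, §5 (arXiv pp. 11–13): the proof of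
Theorem 5.1 rests on the dissipation integral `Γ(t) = ∑_b γ_b ∫₀ᵗ p_b²` and on the scaling
`p ~ H^{1/2}`, `q ~ H^{1/ℓ_p}`, `δq ~ H^{1/ℓ_i}` (Lemma 5.10). For the flow
`z = chainFlow x η` of the pinned chain (`U = ω₂q²/2 + lam q⁴/4`, `V = r²/2 + βr⁴/4`,
`LangevinChainSDE.lean`) driven by a continuous momentum-noise path `η`, with smooth part
`y = z - (0, η)`, this file proves, writing the energy scale as `E = K⁴` (`K ≥ 1`, integer powers
only):

* `pinnedChain_abs_deriv_U_le_scale`, `abs_deriv_V_le_scale`, `pinnedChain_abs_momentum_le_scale`,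
  `pinnedChain_sum_abs_partialQ_le_scale`, `pinnedChain_linearEnergyBound_scale` — **Lemma 5.10 in
  linear form**: `|U'(q_i)|, |V'(δq)| ≤ 4H/K + C K³`, `|p_i| ≤ H/K² + K²/2`, hence
  `∑_i|∂_{q_i}H| + 2γ∑_i|p_i| ≤ (A/K) H + B K³` (`A = pinnedChainScaleA ≥ 1`,
  `B = pinnedChainScaleB`): at energies `≍ K⁴` the forces are `O(K³)`, and the slope `A/K → 0`.
* `pinnedChain_hamiltonian_chainFlow_le_scale`, `pinnedChain_hamiltonian_chainFlow_le_ceiling` —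
  **Grönwall at scale `K`**: `H(y(t)) + (B/A)K⁴ ≤ (H(x) + (B/A)K⁴) e^{(AM/K)t}` for `‖η‖ ≤ M` on
  `[0, T]`; so from `H(x) ≤ 2K⁴` and `A M T ≤ K` the energy stays `≤ c₁K⁴`
  (`c₁ = pinnedChainScaleC`) — a noise of size `δK` moves the energy by `O(δK⁴)` in time `O(1)`.
* `pinnedChain_hamiltonian_chainFlow_eq_smoothPart` — **the energy identity with the dissipation** (pathwise
  form of (3.3)): `H(z(t)) = H(x) - γ∫₀ᵗ∑_i w_iȳ_i² + ∫₀ᵗ∑_i(∂_{q_i}H(y) - γw_iȳ_i)η_i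
  + ∑_i(ȳ_i(t)η_i(t) + η_i(t)²/2)`, `w_i = [i=0]+[i=N-1]`, `ȳ = y.2`.
* `pinnedChain_hamiltonian_chainFlow_le_sub_dissipation` — **the pathwise energy inequality**:
  under `H(x) ≤ 2K⁴`, `‖η‖ ≤ M` on `[0,T]`, `A M T ≤ K`:
  `H(z(t)) ≤ H(x) - γ∫₀ᵗ∑_i w_iȳ_i² + tM(Ac₁ + B)K³ + NM((c₁ + 1/2)K² + M/2)` — "the main
  contribution to the energy difference comes from (minus) the dissipation integral" (CEHR p. 11).

## References

* N. Cuneo, J.-P. Eckmann, M. Hairer, L. Rey-Bellet, *Non-equilibrium steady states for networks of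
  oscillators*, EJP 23 (2018) no. 55 (arXiv:1712.09413), §3 eq. (3.3), §5 p. 11, Lemma 5.10.
-/

noncomputable section

open MeasureTheory Filter Topology Set Metric
open scoped NNReal

namespace Literature.MathematicalPhysics.KineticTheory.HeatConduction

open OscillatorChain

/-! ### Scaling bounds at energy scale `K⁴` (CEHR Lemma 5.10 in integer-power form) -/

section ScaleBounds

variable {ω₂ lam β : ℝ}

/-- `|q| ≤ q²/K + K` for `K > 0` (from `(|q| - K)² ≥ 0`). [folklore] -/
theorem abs_le_sq_div_add_self (q : ℝ) {K : ℝ} (hK : 0 < K) : |q| ≤ q ^ 2 / K + K := by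
  rw [div_add' _ _ _ hK.ne', le_div_iff₀ hK]
  nlinarith [sq_nonneg (|q| - K), sq_abs q, abs_nonneg q]

/-- `|q|³ ≤ q⁴/K + K³` for `K > 0` (weighted AM–GM `4K|q|³ ≤ 3q⁴ + K⁴`). [folklore] -/
theorem abs_pow_three_le_pow_four_div_add (q : ℝ) {K : ℝ} (hK : 0 < K) :
    |q| ^ 3 ≤ q ^ 4 / K + K ^ 3 := by
  set a := |q| with ha
  have ha0 : 0 ≤ a := abs_nonneg q
  have h4 : a ^ 4 = q ^ 4 := Even.pow_abs (by decide) q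
  have key : K * a ^ 3 ≤ a ^ 4 + K ^ 4 := by
    nlinarith [mul_nonneg (sq_nonneg (a - K)) (by positivity : (0:ℝ) ≤ 3 * a ^ 2 + 2 * a * K + K ^ 2),
      pow_nonneg ha0 4, pow_nonneg hK.le 4]
  rw [div_add' _ _ _ hK.ne', le_div_iff₀ hK, ← h4]
  nlinarith [key]

/-- `|p| ≤ p²/(2K²) + K²/2` for `K > 0`. [folklore] -/
theorem abs_le_sq_div_sq_add (p : ℝ) {K : ℝ} (hK : 0 < K) : |p| ≤ p ^ 2 / (2 * K ^ 2) + K ^ 2 / 2 := by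
  have hK2 : 0 < 2 * K ^ 2 := by positivity
  rw [div_add_div _ _ hK2.ne' two_ne_zero, le_div_iff₀ (by positivity)]
  nlinarith [sq_nonneg (|p| - K ^ 2), sq_abs p, abs_nonneg p, sq_nonneg K]

/-- `|U'(q_i)| ≤ 4H/K + (ω₂ + lam) K³` for the pinned chain at scale `K ≥ 1` (`ω₂ > 0`,
`lam, β ≥ 0`; no fractional powers: `ω₂|q| ≤ ω₂(q²/K + K)`, `lam|q|³ ≤ lam(q⁴/K + K³)` and
`ω₂q² + lam q⁴ ≤ 4H`). [cite: CuneoEckmannHairerReyBellet2018, Lemma 5.10] -/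
theorem pinnedChain_abs_deriv_U_le_scale (hω : 0 < ω₂) (hl : 0 ≤ lam) (hβ : 0 ≤ β) (γ : ℝ)
    (N : ℕ) {K : ℝ} (hK : 1 ≤ K) (x : PhaseSpace N) (i : Fin N) :
    |deriv (pinnedChain ω₂ lam β γ).U (x.1 i)| ≤
      4 * (pinnedChain ω₂ lam β γ).hamiltonian N x / K + (ω₂ + lam) * K ^ 3 := by
  set h := (pinnedChain ω₂ lam β γ).hamiltonian N x
  set q := x.1 i
  have hK0 : 0 < K := by linarith
  have hU : ω₂ * q ^ 2 / 2 + lam * q ^ 4 / 4 ≤ h := pinnedChain_U_le_hamiltonian hω.le hl hβ γ N x i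
  rw [pinnedChain_deriv_U]
  have h1 : |ω₂ * q + lam * q ^ 3| ≤ ω₂ * |q| + lam * |q| ^ 3 := by
    calc |ω₂ * q + lam * q ^ 3| ≤ |ω₂ * q| + |lam * q ^ 3| := abs_add_le _ _
      _ = ω₂ * |q| + lam * |q| ^ 3 := by
          rw [abs_mul, abs_mul, abs_of_pos hω, abs_of_nonneg hl, abs_pow]
  have h2 := mul_le_mul_of_nonneg_left (abs_le_sq_div_add_self q hK0) hω.le
  have h3 := mul_le_mul_of_nonneg_left (abs_pow_three_le_pow_four_div_add q hK0) hl
  have h4 : ω₂ * (q ^ 2 / K + K) + lam * (q ^ 4 / K + K ^ 3) =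
      (ω₂ * q ^ 2 + lam * q ^ 4) / K + (ω₂ * K + lam * K ^ 3) := by
    field_simp
    ring
  have h5 : (ω₂ * q ^ 2 + lam * q ^ 4) / K ≤ 4 * h / K :=
    div_le_div_of_nonneg_right (by nlinarith [mul_nonneg hω.le (sq_nonneg q)]) hK0.le
  have h6 : ω₂ * K + lam * K ^ 3 ≤ (ω₂ + lam) * K ^ 3 := by
    have : K ≤ K ^ 3 := le_self_pow₀ hK (by norm_num)
    nlinarith [hω.le]
  linarith [h1, h2, h3, h4, h5, h6]

/-- `|V'(r)| = |r + βr³| ≤ 4E/K + (1 + β)K³` whenever `r²/2 + βr⁴/4 ≤ E`, at scale `K ≥ 1`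
(`β ≥ 0`). [cite: CuneoEckmannHairerReyBellet2018, Lemma 5.10] -/
theorem abs_deriv_V_le_scale (hβ : 0 ≤ β) {r E K : ℝ} (hK : 1 ≤ K)
    (hE : r ^ 2 / 2 + β * r ^ 4 / 4 ≤ E) :
    |r + β * r ^ 3| ≤ 4 * E / K + (1 + β) * K ^ 3 := by
  have hK0 : 0 < K := by linarith
  have h1 : |r + β * r ^ 3| ≤ |r| + β * |r| ^ 3 := by
    calc |r + β * r ^ 3| ≤ |r| + |β * r ^ 3| := abs_add_le _ _
      _ = |r| + β * |r| ^ 3 := by rw [abs_mul, abs_of_nonneg hβ, abs_pow]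
  have h2 := abs_le_sq_div_add_self r hK0
  have h3 := mul_le_mul_of_nonneg_left (abs_pow_three_le_pow_four_div_add r hK0) hβ
  have h4 : (r ^ 2 / K + K) + β * (r ^ 4 / K + K ^ 3) =
      (r ^ 2 + β * r ^ 4) / K + (K + β * K ^ 3) := by
    field_simp
    ring
  have h5 : (r ^ 2 + β * r ^ 4) / K ≤ 4 * E / K :=
    div_le_div_of_nonneg_right (by nlinarith [sq_nonneg r]) hK0.le
  have h6 : K + β * K ^ 3 ≤ (1 + β) * K ^ 3 := by
    have : K ≤ K ^ 3 := le_self_pow₀ hK (by norm_num)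
    nlinarith
  linarith [h1, h2, h3, h4, h5, h6]

/-- `|p_i| ≤ H/K² + K²/2` for the pinned chain (`ω₂, lam, β ≥ 0`, `K > 0`).
[cite: CuneoEckmannHairerReyBellet2018, Lemma 5.10] -/
theorem pinnedChain_abs_momentum_le_scale (hω : 0 ≤ ω₂) (hl : 0 ≤ lam) (hβ : 0 ≤ β) (γ : ℝ)
    (N : ℕ) {K : ℝ} (hK : 0 < K) (x : PhaseSpace N) (i : Fin N) :
    |x.2 i| ≤ (pinnedChain ω₂ lam β γ).hamiltonian N x / K ^ 2 + K ^ 2 / 2 := by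
  set h := (pinnedChain ω₂ lam β γ).hamiltonian N x
  have hh := pinnedChain_harmonic_le_hamiltonian (ω₂ := ω₂) hl hβ γ N x
  have h0 : 0 ≤ ∑ j, ω₂ * x.1 j ^ 2 / 2 := Finset.sum_nonneg fun j _ => by positivity
  have hp : x.2 i ^ 2 / 2 ≤ ∑ j, x.2 j ^ 2 / 2 :=
    Finset.single_le_sum (f := fun j => x.2 j ^ 2 / 2) (fun j _ => by positivity) (Finset.mem_univ i)
  have hp' : x.2 i ^ 2 / 2 ≤ h := by linarith
  have h1 := abs_le_sq_div_sq_add (x.2 i) hK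
  have h2 : x.2 i ^ 2 / (2 * K ^ 2) ≤ h / K ^ 2 := by
    rw [div_le_div_iff₀ (by positivity) (by positivity)]
    nlinarith [sq_nonneg K]
  linarith

/-- The slope constant `A = 4N(1 + N²) + 2γN + 1 ≥ 1` of the linear energy bound at scale `K`.
[folklore] -/
def pinnedChainScaleA (γ : ℝ) (N : ℕ) : ℝ :=
  4 * N * (1 + (N : ℝ) ^ 2) + 2 * γ * N + 1

/-- The constant `B = N(ω₂ + lam + N²(1 + β)) + γN` of the linear energy bound at scale `K`.
[folklore] -/
def pinnedChainScaleB (ω₂ lam β γ : ℝ) (N : ℕ) : ℝ :=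
  N * (ω₂ + lam + (N : ℝ) ^ 2 * (1 + β)) + γ * N

/-- `A ≥ 1` (`γ ≥ 0`). [folklore] -/
theorem one_le_pinnedChainScaleA {γ : ℝ} (hγ : 0 ≤ γ) (N : ℕ) : 1 ≤ pinnedChainScaleA γ N := by
  unfold pinnedChainScaleA
  have : (0 : ℝ) ≤ 4 * N * (1 + (N : ℝ) ^ 2) + 2 * γ * N := by positivity
  linarith

/-- `B ≥ 0` (`ω₂, lam, β, γ ≥ 0`). [folklore] -/
theorem pinnedChainScaleB_nonneg (hω : 0 ≤ ω₂) (hl : 0 ≤ lam) (hβ : 0 ≤ β) {γ : ℝ} (hγ : 0 ≤ γ)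
    (N : ℕ) : 0 ≤ pinnedChainScaleB ω₂ lam β γ N := by
  unfold pinnedChainScaleB
  positivity

/-- **The force bound at scale `K ≥ 1`**: `∑_i |∂_{q_i}H(x)| ≤ (4N(1+N²)/K) H(x) +
N(ω₂ + lam + N²(1+β)) K³`. [cite: CuneoEckmannHairerReyBellet2018, Lemma 5.10] -/
theorem pinnedChain_sum_abs_partialQ_le_scale (hω : 0 < ω₂) (hl : 0 ≤ lam) (hβ : 0 ≤ β) (γ : ℝ)
    (N : ℕ) {K : ℝ} (hK : 1 ≤ K) (x : PhaseSpace N) :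
    ∑ i, |partialQ i ((pinnedChain ω₂ lam β γ).hamiltonian N) x| ≤
      4 * N * (1 + (N : ℝ) ^ 2) / K * (pinnedChain ω₂ lam β γ).hamiltonian N x +
        N * (ω₂ + lam + (N : ℝ) ^ 2 * (1 + β)) * K ^ 3 := by
  set P := pinnedChain ω₂ lam β γ with hP
  set H := P.hamiltonian N x
  have hK0 : 0 < K := by linarith
  have hH0 : 0 ≤ H := pinnedChain_hamiltonian_nonneg hω.le hl hβ γ N x
  have hUd : Differentiable ℝ P.U :=
    (pinnedChain_contDiff_U ω₂ lam β γ (n := 1)).differentiable one_ne_zero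
  have hVd : Differentiable ℝ P.V :=
    (pinnedChain_contDiff_V ω₂ lam β γ (n := 1)).differentiable one_ne_zero
  have hbond : 0 ≤ 4 * H / K + (1 + β) * K ^ 3 := by positivity
  have hterm : ∀ i : Fin N, |partialQ i (P.hamiltonian N) x| ≤
      (4 * H / K + (ω₂ + lam) * K ^ 3) + N ^ 2 * (4 * H / K + (1 + β) * K ^ 3) := by
    intro i
    rw [P.partialQ_hamiltonian_eq_dPotential hUd hVd, OscillatorChain.dPotential]
    refine (abs_add_le _ _).trans (add_le_add (pinnedChain_abs_deriv_U_le_scale hω hl hβ γ N hK x i) ?_)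
    refine (Finset.abs_sum_le_sum_abs _ _).trans ?_
    have hkl : ∀ k l : Fin N, |(if l.val = k.val + 1 then
        deriv P.V (x.1 l - x.1 k) * ((if l = i then 1 else 0) - (if k = i then 1 else 0)) else 0)| ≤
        4 * H / K + (1 + β) * K ^ 3 := by
      intro k l
      have hs : |((if l = i then (1 : ℝ) else 0) - (if k = i then 1 else 0))| ≤ 1 := by
        split_ifs <;> norm_num
      by_cases hlk : l.val = k.val + 1
      · rw [if_pos hlk, abs_mul]
        have hV' : |deriv P.V (x.1 l - x.1 k)| ≤ 4 * H / K + (1 + β) * K ^ 3 := by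
          rw [hP, pinnedChain_deriv_V]
          exact abs_deriv_V_le_scale hβ hK (pinnedChain_bond_le_hamiltonian hω.le hl hβ γ N x hlk)
        calc |deriv P.V (x.1 l - x.1 k)| *
              |((if l = i then (1 : ℝ) else 0) - (if k = i then 1 else 0))|
            ≤ (4 * H / K + (1 + β) * K ^ 3) * 1 := mul_le_mul hV' hs (abs_nonneg _) hbond
          _ = _ := mul_one _
      · rw [if_neg hlk, abs_zero]
        exact hbond
    calc ∑ k : Fin N, |∑ l : Fin N, (if l.val = k.val + 1 then
          deriv P.V (x.1 l - x.1 k) * ((if l = i then 1 else 0) - (if k = i then 1 else 0)) else 0)|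
        ≤ ∑ k : Fin N, ∑ l : Fin N, (4 * H / K + (1 + β) * K ^ 3) :=
          Finset.sum_le_sum fun k _ => (Finset.abs_sum_le_sum_abs _ _).trans
            (Finset.sum_le_sum fun l _ => hkl k l)
      _ = N ^ 2 * (4 * H / K + (1 + β) * K ^ 3) := by simp; ring
  calc ∑ i, |partialQ i (P.hamiltonian N) x|
      ≤ ∑ _i : Fin N, ((4 * H / K + (ω₂ + lam) * K ^ 3) + N ^ 2 * (4 * H / K + (1 + β) * K ^ 3)) :=
        Finset.sum_le_sum fun i _ => hterm i
    _ = _ := by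
        simp only [Finset.sum_const, Finset.card_univ, Fintype.card_fin, nsmul_eq_mul]
        field_simp
        ring

/-- **The linear energy bound at scale `K ≥ 1`**:
`∑_i |∂_{q_i}H| + 2γ ∑_i |p_i| ≤ (A/K) H + B K³` with `A = pinnedChainScaleA`,
`B = pinnedChainScaleB` (`ω₂ > 0`, `lam, β, γ ≥ 0`): the slope `A/K → 0`, which is what makes
the energy move by `O(δK⁴)` only under a noise of size `δK` over times `O(1)`.
[cite: CuneoEckmannHairerReyBellet2018, Lemma 5.10] -/
theorem pinnedChain_linearEnergyBound_scale (hω : 0 < ω₂) (hl : 0 ≤ lam) (hβ : 0 ≤ β) {γ : ℝ}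
    (hγ : 0 ≤ γ) (N : ℕ) {K : ℝ} (hK : 1 ≤ K) (x : PhaseSpace N) :
    (∑ i, |partialQ i ((pinnedChain ω₂ lam β γ).hamiltonian N) x|) + 2 * γ * ∑ i, |x.2 i| ≤
      pinnedChainScaleA γ N / K * (pinnedChain ω₂ lam β γ).hamiltonian N x +
        pinnedChainScaleB ω₂ lam β γ N * K ^ 3 := by
  set H := (pinnedChain ω₂ lam β γ).hamiltonian N x
  have hK0 : 0 < K := by linarith
  have hH0 : 0 ≤ H := pinnedChain_hamiltonian_nonneg hω.le hl hβ γ N x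
  have h1 := pinnedChain_sum_abs_partialQ_le_scale hω hl hβ γ N hK x
  have h2 : ∑ i, |x.2 i| ≤ N * (H / K ^ 2 + K ^ 2 / 2) := by
    calc ∑ i, |x.2 i| ≤ ∑ _i : Fin N, (H / K ^ 2 + K ^ 2 / 2) :=
          Finset.sum_le_sum fun i _ => pinnedChain_abs_momentum_le_scale hω.le hl hβ γ N hK0 x i
      _ = N * (H / K ^ 2 + K ^ 2 / 2) := by simp [mul_add]
  have h3 : H / K ^ 2 ≤ H / K := by
    rw [div_le_div_iff₀ (by positivity) hK0]
    have : K ≤ K ^ 2 := le_self_pow₀ hK (by norm_num)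
    nlinarith
  have h4 : K ^ 2 / 2 ≤ K ^ 3 / 2 := by
    have : K ^ 2 ≤ K ^ 3 := pow_le_pow_right₀ hK (by norm_num)
    linarith
  have h5 : 2 * γ * ∑ i, |x.2 i| ≤ 2 * γ * N / K * H + γ * N * K ^ 3 := by
    have := mul_le_mul_of_nonneg_left h2 (by positivity : 0 ≤ 2 * γ)
    have h6 : 2 * γ * (N * (H / K ^ 2 + K ^ 2 / 2)) ≤ 2 * γ * (N * (H / K + K ^ 3 / 2)) := by
      gcongr
    calc 2 * γ * ∑ i, |x.2 i| ≤ 2 * γ * (N * (H / K + K ^ 3 / 2)) := this.trans h6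
      _ = 2 * γ * N / K * H + γ * N * K ^ 3 := by ring
  have h7 : (0 : ℝ) ≤ 1 / K * H := by positivity
  unfold pinnedChainScaleA pinnedChainScaleB
  have e : (4 * N * (1 + (N : ℝ) ^ 2) + 2 * γ * N + 1) / K * H +
      (N * (ω₂ + lam + (N : ℝ) ^ 2 * (1 + β)) + γ * N) * K ^ 3 =
      (4 * N * (1 + (N : ℝ) ^ 2) / K * H + N * (ω₂ + lam + (N : ℝ) ^ 2 * (1 + β)) * K ^ 3) +
        (2 * γ * N / K * H + γ * N * K ^ 3) + 1 / K * H := by ring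
  rw [e]
  linarith

/-- The energy ceiling factor `c₁ = 3(2 + B/A)`: started below `2K⁴` and driven by a noise of
size `M` with `A M T ≤ K`, the smooth part of the flow has energy `≤ c₁K⁴` on `[0, T]`
(`pinnedChain_hamiltonian_chainFlow_le_ceiling`). [folklore] -/
def pinnedChainScaleC (ω₂ lam β γ : ℝ) (N : ℕ) : ℝ :=
  3 * (2 + pinnedChainScaleB ω₂ lam β γ N / pinnedChainScaleA γ N)

/-- `c₁ ≥ 6 ≥ 0`. [folklore] -/
theorem pinnedChainScaleC_nonneg (hω : 0 ≤ ω₂) (hl : 0 ≤ lam) (hβ : 0 ≤ β) {γ : ℝ} (hγ : 0 ≤ γ)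
    (N : ℕ) : 0 ≤ pinnedChainScaleC ω₂ lam β γ N := by
  unfold pinnedChainScaleC
  have hA : 0 < pinnedChainScaleA γ N := lt_of_lt_of_le one_pos (one_le_pinnedChainScaleA hγ N)
  have hB := pinnedChainScaleB_nonneg hω hl hβ hγ N
  positivity

end ScaleBounds

/-! ### Energy along the driven flow: Grönwall at scale `K`, the exact energy identity with the
dissipation, and the pathwise energy inequality -/

section EnergyFlow

variable {ω₂ lam β γ : ℝ} (hω : 0 < ω₂) (hl : 0 ≤ lam) (hβ : 0 ≤ β) (hγ : 0 ≤ γ) (N : ℕ)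
include hω hl hβ hγ

/-- **Grönwall at scale `K ≥ 1`**: along the flow `z = chainFlow x η` of the pinned chain driven
by a continuous noise path with `‖η‖ ≤ M` on `[0, T]`, the energy of the smooth part
`y = z - (0, η)` obeys `H(y(t)) + (B/A)K⁴ ≤ (H(x) + (B/A)K⁴) e^{(AM/K) t}` — the derivative of
`H∘y` is `DH(y)·Y(y + (0,η)) ≤ ‖η‖(∑|∂_qH| + 2γ∑|p|) ≤ M((A/K) H∘y + BK³)`
(`pinnedChain_linearEnergyBound_scale`). [cite: CuneoEckmannHairerReyBellet2018, §5 eq. before (5.7)] -/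
theorem pinnedChain_hamiltonian_chainFlow_le_scale {K : ℝ} (hK : 1 ≤ K) (x : PhaseSpace N)
    {η : ℝ → Fin N → ℝ} (hη : Continuous η) {T M : ℝ} (hM : ∀ t ∈ Icc 0 T, ‖η t‖ ≤ M) :
    ∀ t ∈ Icc 0 T,
      (pinnedChain ω₂ lam β γ).hamiltonian N
          ((pinnedChain ω₂ lam β γ).chainFlow N x η t - ((0 : Fin N → ℝ), η t)) +
        pinnedChainScaleB ω₂ lam β γ N / pinnedChainScaleA γ N * K ^ 4 ≤
      ((pinnedChain ω₂ lam β γ).hamiltonian N x +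
          pinnedChainScaleB ω₂ lam β γ N / pinnedChainScaleA γ N * K ^ 4) *
        Real.exp (pinnedChainScaleA γ N * M / K * t) := by
  intro t ht
  set P := pinnedChain ω₂ lam β γ with hP
  set H := P.hamiltonian N with hHdef
  set Y := P.drift N with hYdef
  set z := P.chainFlow N x η with hzdef
  set A := pinnedChainScaleA γ N with hA
  set B := pinnedChainScaleB ω₂ lam β γ N with hB
  set D := B / A * K ^ 4 with hD
  have hT : 0 ≤ T := ht.1.trans ht.2
  have hM0 : 0 ≤ M := (norm_nonneg _).trans (hM 0 ⟨le_rfl, hT⟩)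
  have hK0 : 0 < K := by linarith
  have hA1 : 1 ≤ A := one_le_pinnedChainScaleA hγ N
  have hA0 : 0 < A := by linarith
  have hB0 : 0 ≤ B := pinnedChainScaleB_nonneg hω.le hl hβ hγ N
  have hYc : Continuous Y := (pinnedChain_contDiff_drift ω₂ lam β γ N (n := 0)).continuous
  have hzc : Continuous z := pinnedChain_continuous_chainFlow hω hl hβ hγ N x hη
  have hz_eq : ∀ s ∈ Icc 0 T, z s = forcing x η s + ∫ r in (0 : ℝ)..s, Y (z r) :=
    pinnedChain_isIntegralSolutionOn_chainFlow hω hl hβ hγ N x hη T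
  have hHs : ContDiff ℝ 1 H := pinnedChain_contDiff_hamiltonian ω₂ lam β γ N
  have hHd : Differentiable ℝ H := hHs.differentiable one_ne_zero
  set y : ℝ → PhaseSpace N := fun s => x + ∫ r in (0 : ℝ)..s, Y (z r) with hydef
  have hy_deriv : ∀ s, HasDerivAt y (Y (z s)) s := fun s => by
    have h1 : HasDerivAt (fun u => ∫ r in (0 : ℝ)..u, Y (z r)) (Y (z s)) s :=
      ((hYc.comp hzc).integral_hasStrictDerivAt 0 s).hasDerivAt
    exact h1.const_add x
  have hy_eq : ∀ s ∈ Icc 0 T, y s = z s - ((0 : Fin N → ℝ), η s) := fun s hs => by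
    rw [hz_eq s hs]
    simp only [hydef, forcing]
    abel
  have hz_y : ∀ s ∈ Icc 0 T, z s = ((y s).1, (y s).2 + η s) := fun s hs => by
    rw [hy_eq s hs]; ext i <;> simp
  set f : ℝ → ℝ := fun s => H (y s) + D with hfdef
  have hf_deriv : ∀ s, HasDerivAt f (fderiv ℝ H (y s) (Y (z s))) s := fun s =>
    ((hHd (y s)).hasFDerivAt.comp_hasDerivAt s (hy_deriv s)).add_const D
  have hf_cont : Continuous f := continuous_iff_continuousAt.2 fun s => (hf_deriv s).continuousAt
  have hbound : ∀ s ∈ Ico 0 T, fderiv ℝ H (y s) (Y (z s)) ≤ (A * M / K) * f s + 0 := by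
    intro s hs
    have hs' : s ∈ Icc 0 T := ⟨hs.1, hs.2.le⟩
    rw [hz_y s hs']
    have hγ' : 0 ≤ P.γ := hγ
    have h := P.fderiv_hamiltonian_drift_le hHd hγ' (y s) (η s)
    have hsc := pinnedChain_linearEnergyBound_scale hω hl hβ hγ N hK (y s)
    have hH0 : 0 ≤ H (y s) := pinnedChain_hamiltonian_nonneg hω.le hl hβ γ N (y s)
    have hηs : ‖η s‖ ≤ M := hM s hs'
    have hnn : 0 ≤ (∑ i, |partialQ i H (y s)|) + 2 * P.γ * ∑ i, |(y s).2 i| := by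
      have : 0 ≤ ∑ i, |partialQ i H (y s)| := Finset.sum_nonneg fun i _ => abs_nonneg _
      have : 0 ≤ ∑ i, |(y s).2 i| := Finset.sum_nonneg fun i _ => abs_nonneg _
      positivity
    calc fderiv ℝ H (y s) (Y ((y s).1, (y s).2 + η s))
        ≤ ‖η s‖ * ((∑ i, |partialQ i H (y s)|) + 2 * P.γ * ∑ i, |(y s).2 i|) := h
      _ ≤ M * (A / K * H (y s) + B * K ^ 3) := mul_le_mul hηs hsc hnn hM0
      _ = (A * M / K) * f s + 0 := by
          simp only [hfdef, hD]
          field_simp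
          ring
  have hf0 : f 0 ≤ H x + D := by simp [hfdef, hydef]
  have hG := le_gronwallBound_of_liminf_deriv_right_le (f := f)
    (f' := fun s => fderiv ℝ H (y s) (Y (z s))) (δ := H x + D) (K := A * M / K) (ε := 0) (a := 0)
    (b := T) hf_cont.continuousOn (fun s _ r hr => ?_) hf0 hbound t ht
  · rw [sub_zero, gronwallBound_ε0] at hG
    have hfin : f t = H (z t - ((0 : Fin N → ℝ), η t)) + D := by
      show H (y t) + D = _
      rw [hy_eq t ht]
    rw [hfin] at hG
    exact hG
  · have := ((hf_deriv s).hasDerivWithinAt (s := Ici s)).liminf_right_slope_le hr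
    refine this.mono fun w hw => ?_
    rwa [slope_def_field, div_eq_inv_mul] at hw

/-- **The energy ceiling**: if `H(x) ≤ 2K⁴`, `‖η‖ ≤ M` on `[0, T]` and `A M T ≤ K` (`K ≥ 1`),
then `H(z(t) - (0, η(t))) ≤ c₁ K⁴` on `[0, T]`, `c₁ = pinnedChainScaleC`. [folklore] -/
theorem pinnedChain_hamiltonian_chainFlow_le_ceiling {K : ℝ} (hK : 1 ≤ K) (x : PhaseSpace N)
    (hx : (pinnedChain ω₂ lam β γ).hamiltonian N x ≤ 2 * K ^ 4)
    {η : ℝ → Fin N → ℝ} (hη : Continuous η) {T M : ℝ} (hM : ∀ t ∈ Icc 0 T, ‖η t‖ ≤ M)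
    (hAMT : pinnedChainScaleA γ N * M * T ≤ K) :
    ∀ t ∈ Icc 0 T,
      (pinnedChain ω₂ lam β γ).hamiltonian N
          ((pinnedChain ω₂ lam β γ).chainFlow N x η t - ((0 : Fin N → ℝ), η t)) ≤
        pinnedChainScaleC ω₂ lam β γ N * K ^ 4 := by
  intro t ht
  set A := pinnedChainScaleA γ N with hA
  set B := pinnedChainScaleB ω₂ lam β γ N with hB
  have hT : 0 ≤ T := ht.1.trans ht.2
  have hM0 : 0 ≤ M := (norm_nonneg _).trans (hM 0 ⟨le_rfl, hT⟩)
  have hK0 : 0 < K := by linarith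
  have hA1 : 1 ≤ A := one_le_pinnedChainScaleA hγ N
  have hA0 : 0 < A := by linarith
  have hB0 : 0 ≤ B := pinnedChainScaleB_nonneg hω.le hl hβ hγ N
  have hD0 : 0 ≤ B / A * K ^ 4 := by positivity
  have h1 := pinnedChain_hamiltonian_chainFlow_le_scale hω hl hβ hγ N hK x hη hM t ht
  have hexp : Real.exp (A * M / K * t) ≤ 3 := by
    have h2 : A * M / K * t ≤ 1 := by
      rw [div_mul_eq_mul_div, div_le_one hK0]
      calc A * M * t ≤ A * M * T := mul_le_mul_of_nonneg_left ht.2 (by positivity)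
        _ ≤ K := hAMT
    calc Real.exp (A * M / K * t) ≤ Real.exp 1 := Real.exp_le_exp.2 h2
      _ ≤ 3 := Real.exp_one_lt_three.le
  have h3 : ((pinnedChain ω₂ lam β γ).hamiltonian N x + B / A * K ^ 4) * Real.exp (A * M / K * t) ≤
      (2 * K ^ 4 + B / A * K ^ 4) * 3 :=
    mul_le_mul (by linarith) hexp (Real.exp_pos _).le (by positivity)
  have h4 : (2 * K ^ 4 + B / A * K ^ 4) * 3 - B / A * K ^ 4 ≤ pinnedChainScaleC ω₂ lam β γ N * K ^ 4 := by
    unfold pinnedChainScaleC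
    rw [← hA, ← hB]
    nlinarith
  linarith

/-- **The energy identity along the driven flow, with the dissipation** (the pathwise form of
CEHR (3.3) `LH = ∑_b γ_b(T_b - p_b²)`, the noise momentum `η` in place of Itô's correction): for
`z = chainFlow x η`, `y = z - (0, η)` (whose derivative is the drift `Y(z)`),
`H(z(t)) = H(x) - γ∫₀ᵗ ∑_i w_i ȳ_i² + ∫₀ᵗ ∑_i (∂_{q_i}H(y) - γ w_i ȳ_i) η_i + ∑_i (ȳ_i(t)η_i(t) + η_i(t)²/2)`,
`w_i = [i=0] + [i=N-1]`, `ȳ = y.2`. [cite: CuneoEckmannHairerReyBellet2018, §3 eq. (3.3) and §5 p. 11] -/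
theorem pinnedChain_hamiltonian_chainFlow_eq_smoothPart (x : PhaseSpace N) {η : ℝ → Fin N → ℝ}
    (hη : Continuous η) {t : ℝ} (ht : 0 ≤ t) :
    (pinnedChain ω₂ lam β γ).hamiltonian N ((pinnedChain ω₂ lam β γ).chainFlow N x η t) =
      (pinnedChain ω₂ lam β γ).hamiltonian N x -
        γ * (∫ s in (0 : ℝ)..t, ∑ i, bathWeight N i *
          ((pinnedChain ω₂ lam β γ).chainFlow N x η s - ((0 : Fin N → ℝ), η s)).2 i ^ 2) +
        (∫ s in (0 : ℝ)..t, ∑ i,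
          (partialQ i ((pinnedChain ω₂ lam β γ).hamiltonian N)
              ((pinnedChain ω₂ lam β γ).chainFlow N x η s - ((0 : Fin N → ℝ), η s)) -
            γ * bathWeight N i *
              ((pinnedChain ω₂ lam β γ).chainFlow N x η s - ((0 : Fin N → ℝ), η s)).2 i) * η s i) +
        ∑ i, (((pinnedChain ω₂ lam β γ).chainFlow N x η t - ((0 : Fin N → ℝ), η t)).2 i * η t i +
          η t i ^ 2 / 2) := by
  set P := pinnedChain ω₂ lam β γ with hP
  set H := P.hamiltonian N with hHdef
  set Y := P.drift N with hYdef
  set z := P.chainFlow N x η with hzdef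
  have hYc : Continuous Y := (pinnedChain_contDiff_drift ω₂ lam β γ N (n := 0)).continuous
  have hzc : Continuous z := pinnedChain_continuous_chainFlow hω hl hβ hγ N x hη
  have hz_eq : ∀ s ∈ Icc 0 t, z s = forcing x η s + ∫ r in (0 : ℝ)..s, Y (z r) :=
    pinnedChain_isIntegralSolutionOn_chainFlow hω hl hβ hγ N x hη t
  have hHs : ContDiff ℝ 1 H := pinnedChain_contDiff_hamiltonian ω₂ lam β γ N
  have hHd : Differentiable ℝ H := hHs.differentiable one_ne_zero
  set y : ℝ → PhaseSpace N := fun s => x + ∫ r in (0 : ℝ)..s, Y (z r) with hydef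
  have hy_deriv : ∀ s, HasDerivAt y (Y (z s)) s := fun s => by
    have h1 : HasDerivAt (fun u => ∫ r in (0 : ℝ)..u, Y (z r)) (Y (z s)) s :=
      ((hYc.comp hzc).integral_hasStrictDerivAt 0 s).hasDerivAt
    exact h1.const_add x
  have hyc : Continuous y := continuous_iff_continuousAt.2 fun s => (hy_deriv s).continuousAt
  have hy_eq : ∀ s ∈ Icc 0 t, y s = z s - ((0 : Fin N → ℝ), η s) := fun s hs => by
    rw [hz_eq s hs]
    simp only [hydef, forcing]
    abel
  have hz_y : ∀ s ∈ Icc 0 t, z s = ((y s).1, (y s).2 + η s) := fun s hs => by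
    rw [hy_eq s hs]; ext i <;> simp
  -- the derivative of the energy of the smooth part, and its closed form
  set ψ : ℝ → ℝ := fun s => fderiv ℝ H (y s) (Y (z s)) with hψ
  have hg_deriv : ∀ s, HasDerivAt (fun s => H (y s)) (ψ s) s := fun s =>
    (hHd (y s)).hasFDerivAt.comp_hasDerivAt s (hy_deriv s)
  have hψc : Continuous ψ := ((hHs.continuous_fderiv one_ne_zero).comp hyc).clm_apply (hYc.comp hzc)
  set W : ℝ → ℝ := fun s =>
    ∑ i, (partialQ i H (y s) - γ * bathWeight N i * (y s).2 i) * η s i with hW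
  set Dis : ℝ → ℝ := fun s => ∑ i, bathWeight N i * (y s).2 i ^ 2 with hDis
  have hψ_eq : ∀ s ∈ Icc 0 t, ψ s = W s - γ * Dis s := by
    intro s hs
    simp only [hψ, hW, hDis]
    rw [hz_y s hs, P.fderiv_hamiltonian_apply hHd]
    simp only [hYdef, OscillatorChain.drift, P.partialQ_hamiltonian_fst, Pi.add_apply]
    rw [Finset.mul_sum, ← Finset.sum_sub_distrib]
    refine Finset.sum_congr rfl fun i _ => ?_
    have hPγ : P.γ = γ := rfl
    rw [hPγ]
    ring
  -- the fundamental theorem of calculus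
  have hFTC : ∫ s in (0 : ℝ)..t, ψ s = H (y t) - H (y 0) :=
    intervalIntegral.integral_eq_sub_of_hasDerivAt (fun s _ => hg_deriv s) (hψc.intervalIntegrable 0 t)
  have hy0 : y 0 = x := by simp [hydef]
  have hQc : ∀ i, Continuous fun s => partialQ i H (y s) := fun i =>
    (P.continuous_partialQ_hamiltonian hHs i).comp hyc
  have hy2c : ∀ i, Continuous fun s => (y s).2 i := fun i =>
    (continuous_apply i).comp (continuous_snd.comp hyc)
  have hηc : ∀ i, Continuous fun s => η s i := fun i => (continuous_apply i).comp hη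
  have hWc : Continuous W := by
    simp only [hW]
    exact continuous_finsetSum _ fun i _ =>
      ((hQc i).sub (continuous_const.mul (hy2c i))).mul (hηc i)
  have hDisc : Continuous Dis := by
    simp only [hDis]
    exact continuous_finsetSum _ fun i _ => continuous_const.mul ((hy2c i).pow 2)
  have hsplit : ∫ s in (0 : ℝ)..t, ψ s = (∫ s in (0 : ℝ)..t, W s) - γ * ∫ s in (0 : ℝ)..t, Dis s := by
    rw [intervalIntegral.integral_congr (fun s hs => hψ_eq s (by rwa [uIcc_of_le ht] at hs)),
      intervalIntegral.integral_sub (hWc.intervalIntegrable _ _)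
        ((hDisc.const_mul γ).intervalIntegrable _ _),
      intervalIntegral.integral_const_mul]
  -- the total energy at time `t`
  have hzt : H (z t) = H (y t) + ∑ i, ((y t).2 i * η t i + η t i ^ 2 / 2) := by
    rw [hz_y t ⟨ht, le_rfl⟩]
    exact P.hamiltonian_add_momentum N (y t) (η t)
  -- the integrands of the statement, in terms of `y`
  have hW' : ∫ s in (0 : ℝ)..t, ∑ i, (partialQ i H (z s - ((0 : Fin N → ℝ), η s)) -
        γ * bathWeight N i * (z s - ((0 : Fin N → ℝ), η s)).2 i) * η s i =
      ∫ s in (0 : ℝ)..t, W s :=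
    intervalIntegral.integral_congr fun s hs => by
      have hs' : s ∈ Icc 0 t := by rwa [uIcc_of_le ht] at hs
      simp only [hW, hy_eq s hs']
  have hDis' : ∫ s in (0 : ℝ)..t, ∑ i, bathWeight N i * (z s - ((0 : Fin N → ℝ), η s)).2 i ^ 2 =
      ∫ s in (0 : ℝ)..t, Dis s :=
    intervalIntegral.integral_congr fun s hs => by
      have hs' : s ∈ Icc 0 t := by rwa [uIcc_of_le ht] at hs
      simp only [hDis, hy_eq s hs']
  rw [hW', hDis', hzt, hy_eq t ⟨ht, le_rfl⟩]
  rw [hy_eq t ⟨ht, le_rfl⟩, hy0] at hFTC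
  linarith

/-- **The pathwise energy inequality** (CEHR §5, p. 11: "the main contribution to the energy
difference `H(z_{t*}) - H(z₀)` comes from (minus) the dissipation integral"): if `H(x) ≤ 2K⁴`,
`‖η‖ ≤ M` on `[0, T]` and `A M T ≤ K` (`K ≥ 1`), then for `t ∈ [0, T]`
`H(z(t)) ≤ H(x) - γ∫₀ᵗ ∑_i w_i ȳ_i² + t M (A c₁ + B) K³ + N M ((c₁ + 1/2) K² + M/2)`.
[cite: CuneoEckmannHairerReyBellet2018, §5 p. 11 and Lemma 5.10] -/
theorem pinnedChain_hamiltonian_chainFlow_le_sub_dissipation {K : ℝ} (hK : 1 ≤ K) (x : PhaseSpace N)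
    (hx : (pinnedChain ω₂ lam β γ).hamiltonian N x ≤ 2 * K ^ 4)
    {η : ℝ → Fin N → ℝ} (hη : Continuous η) {T M : ℝ} (hM : ∀ t ∈ Icc 0 T, ‖η t‖ ≤ M)
    (hAMT : pinnedChainScaleA γ N * M * T ≤ K) {t : ℝ} (ht : t ∈ Icc 0 T) :
    (pinnedChain ω₂ lam β γ).hamiltonian N ((pinnedChain ω₂ lam β γ).chainFlow N x η t) ≤
      (pinnedChain ω₂ lam β γ).hamiltonian N x -
        γ * (∫ s in (0 : ℝ)..t, ∑ i, bathWeight N i *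
          ((pinnedChain ω₂ lam β γ).chainFlow N x η s - ((0 : Fin N → ℝ), η s)).2 i ^ 2) +
        t * M * ((pinnedChainScaleA γ N * pinnedChainScaleC ω₂ lam β γ N +
          pinnedChainScaleB ω₂ lam β γ N) * K ^ 3) +
        N * M * ((pinnedChainScaleC ω₂ lam β γ N + 1 / 2) * K ^ 2 + M / 2) := by
  set P := pinnedChain ω₂ lam β γ with hP
  set H := P.hamiltonian N with hHdef
  set z := P.chainFlow N x η with hzdef
  set A := pinnedChainScaleA γ N with hA
  set B := pinnedChainScaleB ω₂ lam β γ N with hB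
  set c₁ := pinnedChainScaleC ω₂ lam β γ N with hc₁
  have hT : 0 ≤ T := ht.1.trans ht.2
  have hM0 : 0 ≤ M := (norm_nonneg _).trans (hM 0 ⟨le_rfl, hT⟩)
  have hK0 : 0 < K := by linarith
  have hA1 : 1 ≤ A := one_le_pinnedChainScaleA hγ N
  have hB0 : 0 ≤ B := pinnedChainScaleB_nonneg hω.le hl hβ hγ N
  have hc0 : 0 ≤ c₁ := pinnedChainScaleC_nonneg hω.le hl hβ hγ N
  have hHs : ContDiff ℝ 1 H := pinnedChain_contDiff_hamiltonian ω₂ lam β γ N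
  -- the energy ceiling and the bounds it implies along `[0, T]`
  have hceil : ∀ s ∈ Icc 0 T, H (z s - ((0 : Fin N → ℝ), η s)) ≤ c₁ * K ^ 4 :=
    pinnedChain_hamiltonian_chainFlow_le_ceiling hω hl hβ hγ N hK x hx hη hM hAMT
  have hforce : ∀ s ∈ Icc 0 T,
      (∑ i, |partialQ i H (z s - ((0 : Fin N → ℝ), η s))|) +
          2 * γ * ∑ i, |(z s - ((0 : Fin N → ℝ), η s)).2 i| ≤ (A * c₁ + B) * K ^ 3 := by
    intro s hs
    have h1 := pinnedChain_linearEnergyBound_scale hω hl hβ hγ N hK (z s - ((0 : Fin N → ℝ), η s))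
    have h2 : A / K * H (z s - ((0 : Fin N → ℝ), η s)) ≤ A / K * (c₁ * K ^ 4) :=
      mul_le_mul_of_nonneg_left (hceil s hs) (by positivity)
    have h3 : A / K * (c₁ * K ^ 4) = A * c₁ * K ^ 3 := by
      rw [div_mul_eq_mul_div, div_eq_iff hK0.ne']
      ring
    linarith
  have hmom : ∀ s ∈ Icc 0 T, ∀ i, |(z s - ((0 : Fin N → ℝ), η s)).2 i| ≤ (c₁ + 1 / 2) * K ^ 2 := by
    intro s hs i
    have h1 := pinnedChain_abs_momentum_le_scale hω.le hl hβ γ N hK0 (z s - ((0 : Fin N → ℝ), η s)) i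
    have h2 : H (z s - ((0 : Fin N → ℝ), η s)) / K ^ 2 ≤ c₁ * K ^ 4 / K ^ 2 :=
      div_le_div_of_nonneg_right (hceil s hs) (by positivity)
    have h3 : c₁ * K ^ 4 / K ^ 2 = c₁ * K ^ 2 := by
      rw [div_eq_iff (pow_ne_zero 2 hK0.ne')]
      ring
    linarith
  -- the forcing work
  have hwork : ∫ s in (0 : ℝ)..t, ∑ i, (partialQ i H (z s - ((0 : Fin N → ℝ), η s)) -
        γ * bathWeight N i * (z s - ((0 : Fin N → ℝ), η s)).2 i) * η s i ≤
      t * M * ((A * c₁ + B) * K ^ 3) := by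
    have hb : ∀ s ∈ uIoc (0 : ℝ) t, ‖∑ i, (partialQ i H (z s - ((0 : Fin N → ℝ), η s)) -
        γ * bathWeight N i * (z s - ((0 : Fin N → ℝ), η s)).2 i) * η s i‖ ≤
        M * ((A * c₁ + B) * K ^ 3) := by
      intro s hs
      have hs' : s ∈ Icc 0 T := by
        rw [uIoc_of_le ht.1] at hs
        exact ⟨hs.1.le, hs.2.trans ht.2⟩
      rw [Real.norm_eq_abs]
      refine (Finset.abs_sum_le_sum_abs _ _).trans ?_
      have hηi : ∀ i, |η s i| ≤ M := fun i =>
        (show |η s i| ≤ ‖η s‖ by rw [← Real.norm_eq_abs]; exact norm_le_pi_norm (η s) i).trans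
          (hM s hs')
      have hw0 : ∀ i, 0 ≤ bathWeight N i := fun i => by unfold bathWeight; split_ifs <;> norm_num
      have hw2 : ∀ i, bathWeight N i ≤ 2 := fun i => by unfold bathWeight; split_ifs <;> norm_num
      have hterm : ∀ i, |(partialQ i H (z s - ((0 : Fin N → ℝ), η s)) -
          γ * bathWeight N i * (z s - ((0 : Fin N → ℝ), η s)).2 i) * η s i| ≤
          (|partialQ i H (z s - ((0 : Fin N → ℝ), η s))| +
            2 * γ * |(z s - ((0 : Fin N → ℝ), η s)).2 i|) * M := by
        intro i
        rw [abs_mul]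
        refine mul_le_mul ?_ (hηi i) (abs_nonneg _) (by positivity)
        refine (abs_sub _ _).trans (add_le_add le_rfl ?_)
        rw [abs_mul, abs_mul, abs_of_nonneg hγ, abs_of_nonneg (hw0 i)]
        have := hw2 i
        have : γ * bathWeight N i * |(z s - ((0 : Fin N → ℝ), η s)).2 i| ≤
            γ * 2 * |(z s - ((0 : Fin N → ℝ), η s)).2 i| := by gcongr
        linarith
      calc ∑ i, |(partialQ i H (z s - ((0 : Fin N → ℝ), η s)) -
            γ * bathWeight N i * (z s - ((0 : Fin N → ℝ), η s)).2 i) * η s i|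
          ≤ ∑ i, (|partialQ i H (z s - ((0 : Fin N → ℝ), η s))| +
              2 * γ * |(z s - ((0 : Fin N → ℝ), η s)).2 i|) * M := Finset.sum_le_sum fun i _ => hterm i
        _ = ((∑ i, |partialQ i H (z s - ((0 : Fin N → ℝ), η s))|) +
              2 * γ * ∑ i, |(z s - ((0 : Fin N → ℝ), η s)).2 i|) * M := by
            rw [← Finset.sum_mul, Finset.sum_add_distrib, Finset.mul_sum]
        _ ≤ (A * c₁ + B) * K ^ 3 * M := mul_le_mul_of_nonneg_right (hforce s hs') hM0
        _ = M * ((A * c₁ + B) * K ^ 3) := by ring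
    have h := intervalIntegral.norm_integral_le_of_norm_le_const hb
    rw [Real.norm_eq_abs, sub_zero, abs_of_nonneg ht.1] at h
    have := le_abs_self (∫ s in (0 : ℝ)..t, ∑ i, (partialQ i H (z s - ((0 : Fin N → ℝ), η s)) -
        γ * bathWeight N i * (z s - ((0 : Fin N → ℝ), η s)).2 i) * η s i)
    nlinarith
  -- the final-time correction
  have hfin : ∑ i, ((z t - ((0 : Fin N → ℝ), η t)).2 i * η t i + η t i ^ 2 / 2) ≤
      N * M * ((c₁ + 1 / 2) * K ^ 2 + M / 2) := by
    have hηi : ∀ i, |η t i| ≤ M := fun i =>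
      (show |η t i| ≤ ‖η t‖ by rw [← Real.norm_eq_abs]; exact norm_le_pi_norm (η t) i).trans (hM t ht)
    have hterm : ∀ i, (z t - ((0 : Fin N → ℝ), η t)).2 i * η t i + η t i ^ 2 / 2 ≤
        M * ((c₁ + 1 / 2) * K ^ 2 + M / 2) := by
      intro i
      have h1 : (z t - ((0 : Fin N → ℝ), η t)).2 i * η t i ≤ (c₁ + 1 / 2) * K ^ 2 * M := by
        calc (z t - ((0 : Fin N → ℝ), η t)).2 i * η t i
            ≤ |(z t - ((0 : Fin N → ℝ), η t)).2 i * η t i| := le_abs_self _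
          _ = |(z t - ((0 : Fin N → ℝ), η t)).2 i| * |η t i| := abs_mul _ _
          _ ≤ (c₁ + 1 / 2) * K ^ 2 * M :=
              mul_le_mul (hmom t ht i) (hηi i) (abs_nonneg _) (by positivity)
      have h2 : η t i ^ 2 ≤ M ^ 2 := by
        have := hηi i
        rw [← sq_abs]
        exact pow_le_pow_left₀ (abs_nonneg _) this 2
      nlinarith
    calc ∑ i, ((z t - ((0 : Fin N → ℝ), η t)).2 i * η t i + η t i ^ 2 / 2)
        ≤ ∑ _i : Fin N, M * ((c₁ + 1 / 2) * K ^ 2 + M / 2) := Finset.sum_le_sum fun i _ => hterm i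
      _ = N * M * ((c₁ + 1 / 2) * K ^ 2 + M / 2) := by
          simp only [Finset.sum_const, Finset.card_univ, Fintype.card_fin, nsmul_eq_mul]
          ring
  have hid := pinnedChain_hamiltonian_chainFlow_eq_smoothPart hω hl hβ hγ N x hη ht.1
  rw [← hP, ← hHdef, ← hzdef] at hid
  linarith [hid, hwork, hfin]

end EnergyFlow

end Literature.MathematicalPhysics.KineticTheory.HeatConduction
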